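import Literature.AlgebraicGeometry.RelativeSpec.PullbackIsoDiscrepancy
import Literature.AlgebraicGeometry.Modules.EquivariantStructureRestrictOfPullback
import Literature.AlgebraicGeometry.Modules.PullbackTensor
import Literature.AlgebraicGeometry.Modules.TensorLinear
import HarnessLib

/-!
# The discrepancy of a tensor product of isomorphisms `p^*F₁ ≅ p^*F₀`, `p^*F₁′ ≅ p^*F₀′` is the product of the discrepancies

Layer `Literature/AlgebraicGeometry/RelativeSpec`, namespaces `Literature.AlgebraicGeometry.RelativeSpec` (§1) and
`Literature.AlgebraicGeometry.RelativeSpec.ActionOver` (§2).  THEOREMS ONLY (no definition, no named fact, no instance, no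
notation, no `sorry`).  Sequel to ★ `RelativeSpec/PullbackIsoDiscrepancy` (the discrepancy `r_g ∈ Γ(X, 𝒪_X)` of an isomorphism
`e : p^* F₁ ≅ p^* F₀` against the canonical linearisations ★ `EquivariantStructure.ofPullback ρ Fᵢ` of an action
`ρ : ActionOver p G`, `σ_g^*(e) ≫ can⁰_g = can¹_g ≫ e ≫ (r_g · 𝟙)`), ★ `Modules/EquivariantStructureRestrictOfPullback`
(`ofPullback` on pulled-back sections, frame extensionality) and ★ `Modules/PullbackTensor` (the comparison
`θ_f : f^*(M ⊗ N) ≅ f^*M ⊗ f^*N` for finite locally free `M`, `N`, with its values on pulled-back elementary tensors).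

Cell `hodgecm-mathlib` (D-0151), FLOOR 0, P6 «MOD programme» (crux hLiu418 = stmt-HodgeConjecture-24832), W-line
`Cruxes/HLiu418/Lines/F0_P6b_WeilCartierDuality.lean`, letter `stub_W1` «WeilPairingNatural», σ1 road of record (B-p08 (g32)
`F0/P6/B-p08/g32/ROAD-sigma1-WeilPairingNatural.v1.B-p08g32.md`), organ **(σ1-c)** «multiplicativity of the `e_n`-pairing in the
dual variable»: its MISSING GENERIC LEMMA «the discrepancy of `e ⊗ e′` is the product of the discrepancies» (B-p18 (g37)).
HC_CM is proved only modulo the printed citations until rung 0 closes; nothing here is about HC.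

THE MATHEMATICS ([MumfordAV1970] §20 p. 184, the sentence «`e_n(x, L ⊗ L′) = e_n(x, L) · e_n(x, L′)` since the tensor product
of the two trivialisations of `n_X^* L`, `n_X^* L′` is a trivialisation of `n_X^*(L ⊗ L′)`»; [MumfordFogartyKirwan1994] Ch. 1 §3
Def. 1.6: the tensor product of two `G`-linearised sheaves is `G`-linearised by the tensor product of the structures):
* §1 **`ofPullback_iso_hom_tensor`** — THE CANONICAL LINEARISATION OF `p^*(F ⊗ F′)` IS THE TENSOR PRODUCT OF THE CANONICAL
  LINEARISATIONS of `p^*F` and `p^*F′`, under the comparisons `θ_p : p^*(F ⊗ F′) ≅ p^*F ⊗ p^*F′` and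
  `θ_{σ_g} : σ_g^*(p^*F ⊗ p^*F′) ≅ σ_g^*p^*F ⊗ σ_g^*p^*F′`:
  `σ_g^*(θ_p) ≫ θ_{σ_g} ≫ (can_g ⊗ can′_g) = can^{F⊗F′}_g ≫ θ_p` (`F`, `F′` finite locally free).  Proof: both sides are
  morphisms out of `σ_g^* p^*(F ⊗ F′)`; near every point `p^*(F ⊗ F′)` has the frame `η_p(b_i ⊗ c_j)` made of pulled-back
  elementary tensors of a frame pair `(b, c)` of `(F, F′)` (★ `exists_framePair`, ★ `frame_prod_tensorObj_bijective`, ★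
  `frame_unitSection_bijective`), and on `η_{σ_g}(η_p(b_i ⊗ c_j))` both sides equal `(η_p b_i ⊗ η_p c_j)` transported along
  `σ_g⁻¹ p⁻¹ U = p⁻¹ U` (★ `ofPullback_iso_hom_app_unitSection`, ★ `pullbackTensorIso_hom_app_unitSection`, ★
  `tensorMap_app_tmulSection`, ★ `val_map_tmulSection`); conclude by ★ `pullback_hom_ext_of_frames`.
* §2 **`discrepancy_tensor`** — for `e : p^*F₁ ≅ p^*F₀`, `e′ : p^*F₁′ ≅ p^*F₀′` with discrepancies `r_g`, `r′_g` (all four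
  modules finite locally free on `Q`), the isomorphism `E := θ_p ≫ (e ⊗ e′) ≫ θ_p⁻¹ : p^*(F₁ ⊗ F₁′) ≅ p^*(F₀ ⊗ F₀′)` has
  discrepancies `r_g · r′_g` (§1 for both pairs, naturality ★ `pullbackTensorIso_hom_naturality`, functoriality ★
  `tensorMap_comp`, and `(r · 𝟙) ⊗ (r′ · 𝟙) = (r r′) · 𝟙` from ★ `tensorMap_globalScalar_id` / `tensorMap_id_globalScalar`).
  No rank hypothesis is needed for this identity; with `p^*F₀`, `p^*F₀′` line bundles it says: THE discrepancy of `E` is `r r′`.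

## References
* [MumfordAV1970] D. Mumford, *Abelian Varieties* (1970), §20 (p. 184), §12 Thm. 1 (p. 112), §7 Prop. 2 (p. 70).
* [MumfordFogartyKirwan1994] D. Mumford, J. Fogarty, F. Kirwan, *GIT*, 3rd ed., Ch. 1 §3 Def. 1.6 (p. 30).
* [StacksProject] The Stacks Project, Tag 01CA (Section 17.16) and Tag 01CD (Lemma 17.16.4: `f^*(𝓕 ⊗ 𝓖) = f^*𝓕 ⊗ f^*𝓖`, functorially).
* [Hartshorne1977] R. Hartshorne, *Algebraic Geometry*, II.5 (p. 110).
-/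

set_option autoImplicit false

noncomputable section

-- `TopCat.Presheaf`/`Scheme.Modules` are not reducible (as in Mathlib's `AlgebraicGeometry/Modules`).
set_option backward.isDefEq.respectTransparency false

universe u

open CategoryTheory Limits AlgebraicGeometry TopologicalSpace Opposite
open Literature.AlgebraicGeometry.Modules Literature.AlgebraicGeometry.Motives
open Literature.AlgebraicGeometry.FormalGeometry.WittGrothendieckExistence.FormalVectorBundlesAlgebraize
open Literature.AlgebraicGeometry.KTheory

namespace Literature.AlgebraicGeometry.RelativeSpec

open Literature.AlgebraicGeometry.HodgeTheory

/-! ## §1 The canonical linearisation of `p^*(F ⊗ F′)` is the tensor product of the canonical linearisations -/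

section OfPullbackTensor

variable {X Q : Scheme.{u}} {p : X ⟶ Q} {G : Type*} [Group G] (ρ : ActionOver p G)
  {F F' : Q.Modules} (hF : IsFiniteLocallyFree F) (hF' : IsFiniteLocallyFree F')

include hF hF' in
/-- **Frames of `p^*(F ⊗ F′)` by pulled-back elementary tensors**: near every point of `X`, a frame pair `(b, c)` of `(F, F′)`
over `U ∋ p(x)` (★ `exists_framePair`) gives the frame `η_p(b_i ⊗ c_j)` of `p^*(F ⊗ F′)` over `p⁻¹U` (★
`frame_prod_tensorObj_bijective`, ★ `frame_unitSection_bijective`, turned into a `free ≅ over` isomorphism with prescribed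
basis sections as in ★ `frame_unitSection_bijective`). [cite: StacksProject, Tag 01CD (Lemma 17.16.4)] [cite: Hartshorne1977, II.5 (p. 110)] -/
theorem exists_frame_unitSection_tmulSection (x : X) :
    ∃ (U : Q.Opens) (_ : p.base x ∈ U) (I K : Type u) (_ : Fintype I) (_ : Fintype K) (b : I → Γ(F, U))
      (c : K → Γ(F', U))
      (e : SheafOfModules.free (I × K) ≅ ((Scheme.Modules.pullback p).obj (tensorObj F F')).over (p ⁻¹ᵁ U)),
      ∀ q : I × K, basisSection e q =
        unitSection p (tensorObj F F') U (tmulSection F F' U (b q.1) (c q.2)) := by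
  classical
  obtain ⟨U, hxU, I, K, _, _, ⟨Fr⟩⟩ := exists_framePair F F' hF hF' (p.base x)
  -- the frame `η(b_i ⊗ c_j)` of `p^*(F ⊗ F')` over `p⁻¹U`
  have hS := frame_unitSection_bijective (f := p) (E := tensorObj F F') (U := U)
    (fun q => (tensorUnitHom F F').app (op U) (Fr.basis U le_rfl q)) (frame_prod_tensorObj_bijective F F' Fr)
  have hq : ∀ q : I × K, (tensorUnitHom F F').app (op U) (Fr.basis U le_rfl q) =
      tmulSection F F' U (Fr.b q.1) (Fr.c q.2) := by
    intro q
    rw [Fr.basis_apply, tmulSection_def]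
    have h1 : res F (le_refl U) (Fr.b q.1) = Fr.b q.1 := presheaf_map_id F _
    have h2 : res F' (le_refl U) (Fr.c q.2) = Fr.c q.2 := presheaf_map_id F' _
    rw [h1, h2]
  obtain ⟨e₁⟩ := PushforwardTransport.nonempty_freeIso_restrict_of_frame _ (p ⁻¹ᵁ U) _ hS
  obtain ⟨e₀⟩ := nonempty_overIso_of_restrictIso e₁
  have htU : Function.Bijective fun a : I × K → Γ(X, p ⁻¹ᵁ U) => ∑ q, a q •
      unitSection p (tensorObj F F') U ((tensorUnitHom F F').app (op U) (Fr.basis U le_rfl q)) := by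
    have h := hS (p ⁻¹ᵁ U) le_rfl
    have hid : ∀ q : I × K, ((Scheme.Modules.pullback p).obj (tensorObj F F')).presheaf.map
        (homOfLE (le_refl (p ⁻¹ᵁ U))).op
          (unitSection p (tensorObj F F') U ((tensorUnitHom F F').app (op U) (Fr.basis U le_rfl q))) =
        unitSection p (tensorObj F F') U ((tensorUnitHom F F').app (op U) (Fr.basis U le_rfl q)) :=
      fun q => presheaf_map_id _ _
    simp_rw [hid] at h
    exact h
  obtain ⟨e, he⟩ := exists_frame_basisSection_eq e₀ _ htU
  refine ⟨U, hxU, I, K, inferInstance, inferInstance, Fr.b, Fr.c, e, fun q => ?_⟩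
  rw [he q]
  beta_reduce
  rw [hq]

/-- **The canonical linearisation of an inverse image of a tensor product is the tensor product of the canonical
linearisations**: for `F`, `F′` finite locally free on `Q`, an action `ρ : ActionOver p G` and `g ∈ G`,
`σ_g^*(θ_p) ≫ θ_{σ_g} ≫ (can_g ⊗ can′_g) = can^{F ⊗ F′}_g ≫ θ_p` as morphisms
`σ_g^* p^*(F ⊗ F′) ⟶ p^*F ⊗ p^*F′`, where `θ` is ★ `pullbackTensorIso` and `can` is ★ `EquivariantStructure.ofPullback`
([MumfordFogartyKirwan1994] Def. 1.6: the tensor product of linearised sheaves; [MumfordAV1970] §7 Prop. 2: the descent datum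
of an inverse image).  Checked on the frames of `exists_frame_unitSection_tmulSection` (★ `pullback_hom_ext_of_frames`).
[cite: MumfordFogartyKirwan1994, Ch. 1 §3 Definition 1.6 (p. 30)] [cite: MumfordAV1970, §7 Prop. 2 (p. 70)] -/
theorem ofPullback_iso_hom_tensor (g : G) :
    (Scheme.Modules.pullback (ρ.autHom g)).map (pullbackTensorIso p hF hF').hom ≫
        (pullbackTensorIso (ρ.autHom g) (hF.pullback p) (hF'.pullback p)).hom ≫
          tensorMap ((ActionOver.EquivariantStructure.ofPullback ρ F).iso g).hom
            ((ActionOver.EquivariantStructure.ofPullback ρ F').iso g).hom =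
      ((ActionOver.EquivariantStructure.ofPullback ρ (tensorObj F F')).iso g).hom ≫
        (pullbackTensorIso p hF hF').hom := by
  classical
  choose U hU I K instI instK b c e he using exists_frame_unitSection_tmulSection (p := p) hF hF'
  letI : ∀ x, Fintype (I x) := instI
  letI : ∀ x, Fintype (K x) := instK
  refine pullback_hom_ext_of_frames (ρ.autHom g) (fun x : X => p ⁻¹ᵁ U x) (fun s => ⟨s, hU s⟩)
    (I := fun x => I x × K x) e fun x q => ?_
  rw [he]
  have hpre : ρ.autHom g ⁻¹ᵁ (p ⁻¹ᵁ U x) = p ⁻¹ᵁ U x := ρ.preimage_preimage g (U x)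
  -- left-hand side: `η_σ η_p (b ⊗ c) ↦ η_σ (η_p b ⊗ η_p c) ↦ η_σ η_p b ⊗ η_σ η_p c ↦ (η_p b)ᵗ ⊗ (η_p c)ᵗ`
  rw [Scheme.Modules.Hom.comp_app, CategoryTheory.comp_apply, Scheme.Modules.Hom.comp_app, CategoryTheory.comp_apply,
    pullback_map_app_unitSection (ρ.autHom g) (pullbackTensorIso p hF hF').hom,
    pullbackTensorIso_hom_app_unitSection, pullbackTensorIso_hom_app_unitSection, tensorMap_app_tmulSection,
    ofPullback_iso_hom_app_unitSection, ofPullback_iso_hom_app_unitSection]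
  -- right-hand side: `η_σ η_p (b ⊗ c) ↦ (η_p (b ⊗ c))ᵗ ↦ (η_p b ⊗ η_p c)ᵗ`
  rw [Scheme.Modules.Hom.comp_app, CategoryTheory.comp_apply, ofPullback_iso_hom_app_unitSection,
    app_presheaf_map (pullbackTensorIso p hF hF').hom, pullbackTensorIso_hom_app_unitSection]
  exact (val_map_tmulSection _ _ (eqToHom hpre).op _ _).symm

end OfPullbackTensor

/-! ## §2 The discrepancy of `e ⊗ e′` is the product of the discrepancies -/

namespace ActionOver

section Tensor

variable {X Q : Scheme.{u}} {p : X ⟶ Q} {G : Type u} [Group G] (ρ : ActionOver p G)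
  {F₀ F₁ F₀' F₁' : Q.Modules} (h₀ : IsFiniteLocallyFree F₀) (h₁ : IsFiniteLocallyFree F₁)
  (h₀' : IsFiniteLocallyFree F₀') (h₁' : IsFiniteLocallyFree F₁')
  (e : (Scheme.Modules.pullback p).obj F₁ ≅ (Scheme.Modules.pullback p).obj F₀)
  (e' : (Scheme.Modules.pullback p).obj F₁' ≅ (Scheme.Modules.pullback p).obj F₀')
  (r r' : G → Γ(X, ⊤))
  (he : ∀ g : G, (Scheme.Modules.pullback (ρ.autHom g)).map e.hom ≫
      ((EquivariantStructure.ofPullback ρ F₀).iso g).hom =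
    ((EquivariantStructure.ofPullback ρ F₁).iso g).hom ≫ e.hom ≫
      globalScalar ((Scheme.Modules.pullback p).obj F₀) (r g))
  (he' : ∀ g : G, (Scheme.Modules.pullback (ρ.autHom g)).map e'.hom ≫
      ((EquivariantStructure.ofPullback ρ F₀').iso g).hom =
    ((EquivariantStructure.ofPullback ρ F₁').iso g).hom ≫ e'.hom ≫
      globalScalar ((Scheme.Modules.pullback p).obj F₀') (r' g))

/-- `(a · 𝟙_P) ⊗ (a′ · 𝟙_P′) = (a a′) · 𝟙_{P ⊗ P′}` for global functions `a`, `a′` (★ `tensorMap_globalScalar_id`, ★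
`tensorMap_id_globalScalar`). [cite: StacksProject, Tag 01CA] -/
theorem tensorMap_globalScalar_globalScalar (P P' : X.Modules) (a a' : Γ(X, ⊤)) :
    tensorMap (globalScalar P a) (globalScalar P' a') = globalScalar (tensorObj P P') (a * a') := by
  rw [← Category.comp_id (globalScalar P a), ← Category.id_comp (globalScalar P' a'), tensorMap_comp,
    tensorMap_globalScalar_id, tensorMap_id_globalScalar, mul_comm, globalScalar_mul]

include he he' in
/-- **THE DISCREPANCY OF A TENSOR PRODUCT IS THE PRODUCT OF THE DISCREPANCIES** ([MumfordAV1970] §20 p. 184: «the tensor product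
of trivialisations of `n_X^*L`, `n_X^*L′` is a trivialisation of `n_X^*(L ⊗ L′)`, whence `e_n(x, L ⊗ L′) = e_n(x, L) e_n(x, L′)`»):
if `e : p^*F₁ ≅ p^*F₀` has discrepancies `r_g` and `e′ : p^*F₁′ ≅ p^*F₀′` has discrepancies `r′_g` against the canonical
linearisations of `ρ`, then `E := θ_p ≫ (e ⊗ e′) ≫ θ_p⁻¹ : p^*(F₁ ⊗ F₁′) ≅ p^*(F₀ ⊗ F₀′)` satisfies
`σ_g^*(E) ≫ can_g = can_g ≫ E ≫ ((r_g r′_g) · 𝟙)` — §1 for `(F₀, F₀′)` and `(F₁, F₁′)`, naturality of `θ_{σ_g}` (★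
`pullbackTensorIso_hom_naturality`), `tensorMap_comp`, `tensorMap_globalScalar_globalScalar`, `globalScalar_comp`.
(All four modules finite locally free on `Q`; no rank hypothesis.) [cite: MumfordAV1970, §20 (p. 184)]
[cite: MumfordFogartyKirwan1994, Ch. 1 §3 Definition 1.6 (p. 30)] -/
theorem discrepancy_tensor (g : G) :
    (Scheme.Modules.pullback (ρ.autHom g)).map
          (pullbackTensorIso p h₁ h₁' ≪≫ tensorMapIso e e' ≪≫ (pullbackTensorIso p h₀ h₀').symm).hom ≫
        ((EquivariantStructure.ofPullback ρ (tensorObj F₀ F₀')).iso g).hom =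
      ((EquivariantStructure.ofPullback ρ (tensorObj F₁ F₁')).iso g).hom ≫
        (pullbackTensorIso p h₁ h₁' ≪≫ tensorMapIso e e' ≪≫ (pullbackTensorIso p h₀ h₀').symm).hom ≫
          globalScalar ((Scheme.Modules.pullback p).obj (tensorObj F₀ F₀')) (r g * r' g) := by
  have k₀ := ofPullback_iso_hom_tensor ρ h₀ h₀' g
  have k₁ := ofPullback_iso_hom_tensor ρ h₁ h₁' g
  -- `σ^*(θ₀⁻¹) ≫ can^{F₀⊗F₀'} = θ_σ ≫ (can₀ ⊗ can₀') ≫ θ₀⁻¹`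
  have k₀' : (Scheme.Modules.pullback (ρ.autHom g)).map (pullbackTensorIso p h₀ h₀').inv ≫
      ((EquivariantStructure.ofPullback ρ (tensorObj F₀ F₀')).iso g).hom =
      (pullbackTensorIso (ρ.autHom g) (h₀.pullback p) (h₀'.pullback p)).hom ≫
        tensorMap ((EquivariantStructure.ofPullback ρ F₀).iso g).hom ((EquivariantStructure.ofPullback ρ F₀').iso g).hom ≫
          (pullbackTensorIso p h₀ h₀').inv := by
    rw [← cancel_epi ((Scheme.Modules.pullback (ρ.autHom g)).map (pullbackTensorIso p h₀ h₀').hom),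
      ← CategoryTheory.Functor.map_comp_assoc, Iso.hom_inv_id, CategoryTheory.Functor.map_id, Category.id_comp,
      ← cancel_mono (pullbackTensorIso p h₀ h₀').hom]
    simp only [Category.assoc, Iso.inv_hom_id, Category.comp_id]
    exact k₀.symm
  have nat := pullbackTensorIso_hom_naturality (ρ.autHom g) (h₁.pullback p) (h₁'.pullback p) (h₀.pullback p)
    (h₀'.pullback p) e.hom e'.hom
  simp only [Iso.trans_hom, Iso.symm_hom, tensorMapIso_hom, CategoryTheory.Functor.map_comp, Category.assoc]
  rw [k₀', reassoc_of% nat, ← Category.assoc (tensorMap _ _) (tensorMap _ _), ← tensorMap_comp, he g, he' g,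
    tensorMap_comp, tensorMap_comp]
  simp only [Category.assoc]
  rw [reassoc_of% k₁, tensorMap_globalScalar_globalScalar, globalScalar_comp]

end Tensor

end ActionOver

end Literature.AlgebraicGeometry.RelativeSpec

end
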